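import Literature.Analysis.SpecialFunctions.SpheroidalSeries
import Literature.Analysis.ODE.LinearSecondOrder
import Mathlib.Analysis.SpecificLimits.Normed
import Mathlib.Topology.Order.IntermediateValue
import HarnessLib

/-!
# A smooth even eigenfunction of the axisymmetric spheroidal equation on `[-1, 1]`

Topic `Literature/Analysis/SpecialFunctions` (namespace `Literature.Analysis.SpecialFunctions`),
continuing `SpheroidalSeries.lean`. For the spheroidicity parameter `c = 1/100` we produce an
eigenvalue `λ ∈ [-1/2, 1/2]` and a function `S`, smooth on the open interval `(-31/11, 31/11)`
containing `[-1, 1]`, even, with `S(1) = 1`, solving the axisymmetric (prolate) spheroidal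
equation
  `(1 - χ²) S'' - 2χ S' + (λ - c χ²) S = 0`
there (`exists_spheroidalEigenfunction`) — i.e. a genuine spheroidal eigenfunction `S(cos θ)`,
smooth across BOTH poles of the sphere (Flammer, *Spheroidal wave functions* (1957), Ch. 2;
NIST DLMF §30.2–30.3: for real `c` the eigenvalues `λₙ(c)` are those `λ` for which the solution
bounded at `χ = 1` is also bounded at `χ = -1`). This is the angular input of separated
axisymmetric Klein–Gordon solutions on Kerr (Shlapentokh-Rothman, CMP 329 (2014), §2, `m = 0`).

Proof (shooting in the eigenvalue parameter, everything proved):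
* the Frobenius solution `S_λ(s) = Σ bₙ(λ) sⁿ` at the pole `χ = 1` (`s = 1 - χ`,
  `SpheroidalSeries.lean`) is analytic on `|s| < 20/11`, i.e. for `χ ∈ (-9/11, 31/11)`;
* by the symmetry `χ ↦ -χ` of the equation, `S_λ(1 - χ)` extends smoothly across the other pole
  iff it is even, iff its `χ`-derivative at `χ = 0` vanishes, i.e. iff the **shooting function**
  `g(λ) = S_λ'(s = 1) = Σ n bₙ(λ)` vanishes (uniqueness for the regular linear ODE at the ordinary
  point `χ = 0`, `Literature.Analysis.ODE.eqOn_of_solution_Ioo`);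
* `g` is continuous on `[-1/2, 1/2]` (`continuousOn_sphDer_one`) and changes sign there:
  `g(1/2) < 0 < g(-1/2)` is CERTIFIED by the exact partial sums `Σ_{n<7} n bₙ(±1/2)` (rational
  arithmetic, `norm_num`) and the tail bound `Σ_{n≥7} n (11/20)ⁿ = p⁷(p/(1-p)² + 7/(1-p))`,
  `p = 11/20` (`abs_sphDer_one_sub_sum_le`); the intermediate value theorem gives `λ`.

## References

* Y. Shlapentokh-Rothman, Comm. Math. Phys. 329 (2014) 859–891, §2 (the angular ODE and its
  Sturm–Liouville eigenvalues `λ_{ml}`). Key `ShlapentokhRothman2014KleinGordon`.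
-/

noncomputable section

open Set Filter Metric Finset
open scoped Topology

namespace Literature.Analysis.SpecialFunctions

/-! ### The certified sign change of the shooting function `g(λ) = S_λ'(1) = Σ n bₙ(λ)` -/

/-- The shooting function as a series: `S_λ'(1) = Σ n bₙ(λ, c)`. [folklore] -/
theorem sphDer_one_eq_tsum (lam c : ℝ) :
    sphDer lam c 1 = ∑' n : ℕ, (n : ℝ) * sphCoeff lam c n := by
  rw [sphDer, psDer]
  exact tsum_congr fun n ↦ by rw [one_pow, mul_one, mul_comm]

/-- The tail of the majorant: `Σ_{n} (n + 7) p^{n+7} = p⁷ (p/(1-p)² + 7/(1-p))`, `p = 11/20`.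
[folklore] -/
theorem hasSum_tail_majorant :
    HasSum (fun n : ℕ ↦ ((n : ℝ) + 7) * (11 / 20 : ℝ) ^ (n + 7))
      ((11 / 20 : ℝ) ^ 7 * ((11 / 20) / (1 - 11 / 20) ^ 2 + 7 / (1 - 11 / 20))) := by
  have hp : ‖(11 / 20 : ℝ)‖ < 1 := by rw [Real.norm_eq_abs, abs_of_pos (by norm_num)]; norm_num
  have h1 : HasSum (fun n : ℕ ↦ (n : ℝ) * (11 / 20 : ℝ) ^ n) ((11 / 20) / (1 - 11 / 20) ^ 2) :=
    hasSum_coe_mul_geometric_of_norm_lt_one hp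
  have h2 : HasSum (fun n : ℕ ↦ (11 / 20 : ℝ) ^ n) (1 - 11 / 20)⁻¹ :=
    hasSum_geometric_of_lt_one (by norm_num) (by norm_num)
  have h := (h1.add (h2.mul_left 7)).mul_left ((11 / 20 : ℝ) ^ 7)
  refine h.congr_fun fun n ↦ ?_
  rw [pow_add]
  ring

/-- **Tail bound for the shooting function**: for `|λ| ≤ 1/2`, `0 ≤ c ≤ 1/100`,
`|S_λ'(1) - Σ_{n<7} n bₙ(λ)| ≤ p⁷ (p/(1-p)² + 7/(1-p))`, `p = 11/20` (from `|bₙ| ≤ pⁿ`).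
[folklore] -/
theorem abs_sphDer_one_sub_sum_le {lam c : ℝ} (hlam : |lam| ≤ 1 / 2) (hc0 : 0 ≤ c)
    (hc1 : c ≤ 1 / 100) :
    |sphDer lam c 1 - ∑ n ∈ range 7, (n : ℝ) * sphCoeff lam c n| ≤
      (11 / 20 : ℝ) ^ 7 * ((11 / 20) / (1 - 11 / 20) ^ 2 + 7 / (1 - 11 / 20)) := by
  have hb := abs_sphCoeff_le hlam hc0 hc1
  have hsum : Summable fun n : ℕ ↦ (n : ℝ) * sphCoeff lam c n := by
    have h := (hasSum_psDer (b := sphCoeff lam c) (p := 11 / 20) (by norm_num) hb (s := 1)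
      (by rw [sph_radius_eq, abs_one]; norm_num)).summable
    refine h.congr fun n ↦ ?_
    rw [one_pow, mul_one, mul_comm]
  rw [sphDer_one_eq_tsum, ← hsum.sum_add_tsum_nat_add 7, add_sub_cancel_left]
  have htail : Summable fun n : ℕ ↦ ((n : ℝ) + 7) * (11 / 20 : ℝ) ^ (n + 7) :=
    hasSum_tail_majorant.summable
  rw [← hasSum_tail_majorant.tsum_eq]
  have h7 : Summable fun n : ℕ ↦ ‖((n + 7 : ℕ) : ℝ) * sphCoeff lam c (n + 7)‖ :=
    ((summable_nat_add_iff 7).2 hsum).norm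
  refine (Real.norm_eq_abs _ ▸ norm_tsum_le_tsum_norm h7).trans
    (Summable.tsum_le_tsum (fun n ↦ ?_) h7 htail)
  rw [Real.norm_eq_abs, abs_mul]
  push_cast
  rw [abs_of_nonneg (by positivity : (0 : ℝ) ≤ n + 7)]
  exact mul_le_mul_of_nonneg_left (hb (n + 7)) (by positivity)

/-- The partial sum `Σ_{n<7} n bₙ(1/2, 1/100)` (exact rational arithmetic). [folklore] -/
theorem sum_range_seven_sphCoeff_half :
    ∑ n ∈ range 7, (n : ℝ) * sphCoeff (1 / 2) (1 / 100) n =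
      -2323263508383571799 / 5529600000000000000 := by
  simp only [sum_range_succ, sum_range_zero, sphCoeff, sphTriple]
  norm_num

/-- The partial sum `Σ_{n<7} n bₙ(-1/2, 1/100)` (exact rational arithmetic). [folklore] -/
theorem sum_range_seven_sphCoeff_neg_half :
    ∑ n ∈ range 7, (n : ℝ) * sphCoeff (-1 / 2) (1 / 100) n =
      3172197703253128801 / 5529600000000000000 := by
  simp only [sum_range_succ, sum_range_zero, sphCoeff, sphTriple]
  norm_num

/-- **Certified sign of the shooting function at `λ = 1/2`**: `S_{1/2}'(1) < 0` (`c = 1/100`;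
`Σ_{n<7} n bₙ ≈ -0.4202`, tail `≤ 0.2782`). [folklore] -/
theorem sphDer_one_half_neg : sphDer (1 / 2) (1 / 100) 1 < 0 := by
  have h := abs_sphDer_one_sub_sum_le (lam := 1 / 2) (c := 1 / 100)
    (abs_le.2 ⟨by norm_num, by norm_num⟩) (by norm_num) (by norm_num)
  rw [sum_range_seven_sphCoeff_half, abs_le] at h
  norm_num at h
  linarith [h.2]

/-- **Certified sign of the shooting function at `λ = -1/2`**: `S_{-1/2}'(1) > 0` (`c = 1/100`;
`Σ_{n<7} n bₙ ≈ 0.5737`, tail `≤ 0.2782`). [folklore] -/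
theorem sphDer_one_neg_half_pos : 0 < sphDer (-1 / 2) (1 / 100) 1 := by
  have h := abs_sphDer_one_sub_sum_le (lam := -1 / 2) (c := 1 / 100)
    (abs_le.2 ⟨by norm_num, by norm_num⟩) (by norm_num) (by norm_num)
  rw [sum_range_seven_sphCoeff_neg_half, abs_le] at h
  norm_num at h
  linarith [h.1]

/-- **An eigenvalue by the intermediate value theorem**: some `λ ∈ [-1/2, 1/2]` has vanishing
shooting function `S_λ'(1) = 0` (`c = 1/100`). DLMF §30.3 (existence of the eigenvalues
`λₙ(c)`); here for one eigenvalue near `λ₀(0) = 0`. [folklore] -/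
theorem exists_sphDer_one_eq_zero :
    ∃ lam : ℝ, lam ∈ Icc (-1 / 2 : ℝ) (1 / 2) ∧ sphDer lam (1 / 100) 1 = 0 := by
  have hcont := continuousOn_sphDer_one (c := 1 / 100) (by norm_num) (by norm_num)
  have hivt := intermediate_value_Icc' (by norm_num : (-1 / 2 : ℝ) ≤ 1 / 2) hcont
  have h0 : (0 : ℝ) ∈ Icc (sphDer (1 / 2) (1 / 100) 1) (sphDer (-1 / 2) (1 / 100) 1) :=
    ⟨sphDer_one_half_neg.le, sphDer_one_neg_half_pos.le⟩
  obtain ⟨lam, hlam, hzero⟩ := hivt h0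
  exact ⟨lam, hlam, hzero⟩

/-! ### The solution in the latitude variable `χ = 1 - s` and its reflection -/

section Chi

variable {lam c : ℝ} (hlam : |lam| ≤ 1 / 2) (hc0 : 0 ≤ c) (hc1 : c ≤ 1 / 100)
include hlam hc0 hc1

/-- The spheroidal equation solved for the second derivative:
`S'' = (-(2 - 2s) S' - (λ - c(1-s)²) S)/(s(2-s))` wherever `s(2 - s) ≠ 0`, `|s| < 20/11`.
[folklore] -/
theorem sphDer₂_eq {s : ℝ} (hs : |s| < 20 / 11) (hs0 : s * (2 - s) ≠ 0) :
    sphDer₂ lam c s =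
      (-(2 - 2 * s) * sphDer lam c s - (lam - c * (1 - s) ^ 2) * sphFun lam c s) /
        (s * (2 - s)) := by
  rw [eq_div_iff hs0]
  linear_combination sphFun_ode hlam hc0 hc1 hs

/-- **The pole solution in the latitude variable**: `T(χ) = S_λ(1 - χ)` satisfies, for
`χ ∈ (-9/11, 9/11)`, `T' = -S_λ'(1-χ)` and the spheroidal equation in the regular form
`T'' = (2χ T' - (λ - cχ²) T)/(1 - χ²)`. [folklore] -/
theorem hasDerivAt_sphFun_comp_sub {χ : ℝ} (hχ : χ ∈ Ioo (-9 / 11 : ℝ) (9 / 11)) :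
    HasDerivAt (fun x ↦ sphFun lam c (1 - x)) (-sphDer lam c (1 - χ)) χ ∧
    HasDerivAt (fun x ↦ -sphDer lam c (1 - x))
      (2 * χ / (1 - χ ^ 2) * (-sphDer lam c (1 - χ)) +
        (-(lam - c * χ ^ 2) / (1 - χ ^ 2)) * sphFun lam c (1 - χ)) χ := by
  have hs : |1 - χ| < 20 / 11 := by
    rw [abs_lt]; constructor <;> linarith [hχ.1, hχ.2]
  have hχ1 : 1 - χ ^ 2 ≠ 0 := by nlinarith [hχ.1, hχ.2]
  have hsub : HasDerivAt (fun x : ℝ ↦ 1 - x) (-1) χ := by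
    simpa using (hasDerivAt_id χ).const_sub 1
  have hode := sphFun_ode hlam hc0 hc1 hs
  have key : sphDer₂ lam c (1 - χ) * (1 - χ ^ 2) =
      -(2 * χ) * sphDer lam c (1 - χ) - (lam - c * χ ^ 2) * sphFun lam c (1 - χ) := by
    linear_combination hode
  constructor
  · have h := (hasDerivAt_sphFun hlam hc0 hc1 hs).comp χ hsub
    simpa [Function.comp_def] using h
  · have h0 : HasDerivAt (fun x ↦ sphDer lam c (1 - x)) (sphDer₂ lam c (1 - χ) * (-1)) χ := by
      simpa [Function.comp_def] using (hasDerivAt_sphDer hlam hc0 hc1 hs).comp χ hsub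
    have h' : HasDerivAt (fun x ↦ -sphDer lam c (1 - x)) (sphDer₂ lam c (1 - χ)) χ := by
      simpa using h0.fun_neg
    have hval : 2 * χ / (1 - χ ^ 2) * (-sphDer lam c (1 - χ)) +
        (-(lam - c * χ ^ 2) / (1 - χ ^ 2)) * sphFun lam c (1 - χ) = sphDer₂ lam c (1 - χ) := by
      rw [div_mul_eq_mul_div, div_mul_eq_mul_div, ← add_div, div_eq_iff hχ1]
      linear_combination -key
    rw [hval]
    exact h'

/-- **The reflected pole solution** `χ ↦ S_λ(1 + χ)` (analytic at the pole `χ = -1`) satisfies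
the same regular equation on `(-9/11, 9/11)`, with derivative `S_λ'(1 + χ)`. [folklore] -/
theorem hasDerivAt_sphFun_comp_add {χ : ℝ} (hχ : χ ∈ Ioo (-9 / 11 : ℝ) (9 / 11)) :
    HasDerivAt (fun x ↦ sphFun lam c (1 + x)) (sphDer lam c (1 + χ)) χ ∧
    HasDerivAt (fun x ↦ sphDer lam c (1 + x))
      (2 * χ / (1 - χ ^ 2) * sphDer lam c (1 + χ) +
        (-(lam - c * χ ^ 2) / (1 - χ ^ 2)) * sphFun lam c (1 + χ)) χ := by
  have hs : |1 + χ| < 20 / 11 := by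
    rw [abs_lt]; constructor <;> linarith [hχ.1, hχ.2]
  have hχ1 : 1 - χ ^ 2 ≠ 0 := by nlinarith [hχ.1, hχ.2]
  have hadd : HasDerivAt (fun x : ℝ ↦ 1 + x) 1 χ := by
    simpa using (hasDerivAt_id χ).const_add 1
  have hode := sphFun_ode hlam hc0 hc1 hs
  have key : sphDer₂ lam c (1 + χ) * (1 - χ ^ 2) =
      2 * χ * sphDer lam c (1 + χ) - (lam - c * χ ^ 2) * sphFun lam c (1 + χ) := by
    linear_combination hode
  constructor
  · have h := (hasDerivAt_sphFun hlam hc0 hc1 hs).comp χ hadd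
    simpa [Function.comp_def] using h
  · have h := (hasDerivAt_sphDer hlam hc0 hc1 hs).comp χ hadd
    have h' : HasDerivAt (fun x ↦ sphDer lam c (1 + x)) (sphDer₂ lam c (1 + χ)) χ := by
      simpa [Function.comp_def] using h
    have hval : 2 * χ / (1 - χ ^ 2) * sphDer lam c (1 + χ) +
        (-(lam - c * χ ^ 2) / (1 - χ ^ 2)) * sphFun lam c (1 + χ) = sphDer₂ lam c (1 + χ) := by
      rw [div_mul_eq_mul_div, div_mul_eq_mul_div, ← add_div, div_eq_iff hχ1]
      linear_combination -key
    rw [hval]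
    exact h'

/-- **Evenness from the vanishing of the shooting function.** If `S_λ'(1) = 0` then
`S_λ(1 + χ) = S_λ(1 - χ)` for `χ ∈ (-9/11, 9/11)`: both sides solve the regular linear equation
`T'' = (2χ T' - (λ - cχ²)T)/(1 - χ²)` with the same value `S_λ(1)` and the same derivative `0` at
the ordinary point `χ = 0` (`Literature.Analysis.ODE.eqOn_of_solution_Ioo`). [folklore] -/
theorem sphFun_reflect {χ : ℝ} (hg : sphDer lam c 1 = 0) (hχ : χ ∈ Ioo (-9 / 11 : ℝ) (9 / 11)) :
    sphFun lam c (1 + χ) = sphFun lam c (1 - χ) := by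
  have hp : ContinuousOn (fun x : ℝ ↦ 2 * x / (1 - x ^ 2)) (Ioo (-9 / 11 : ℝ) (9 / 11)) := by
    refine ContinuousOn.div (by fun_prop) (by fun_prop) fun x hx ↦ ?_
    nlinarith [hx.1, hx.2]
  have hq : ContinuousOn (fun x : ℝ ↦ -(lam - c * x ^ 2) / (1 - x ^ 2))
      (Ioo (-9 / 11 : ℝ) (9 / 11)) := by
    refine ContinuousOn.div (by fun_prop) (by fun_prop) fun x hx ↦ ?_
    nlinarith [hx.1, hx.2]
  have h0 : (0 : ℝ) ∈ Ioo (-9 / 11 : ℝ) (9 / 11) := ⟨by norm_num, by norm_num⟩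
  have huniq := Literature.Analysis.ODE.eqOn_of_solution_Ioo (𝕜 := ℝ) hp hq h0
    (u := fun x ↦ sphFun lam c (1 + x)) (u' := fun x ↦ sphDer lam c (1 + x))
    (v := fun x ↦ sphFun lam c (1 - x)) (v' := fun x ↦ -sphDer lam c (1 - x))
    (fun x hx ↦ hasDerivAt_sphFun_comp_add hlam hc0 hc1 hx)
    (fun x hx ↦ hasDerivAt_sphFun_comp_sub hlam hc0 hc1 hx) (by simp) (by simp [hg])
  exact huniq.1 hχ

end Chi

/-! ### The glued even eigenfunction -/

/-- **The spheroidal eigenfunction** attached to an eigenvalue `λ`: the even function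
`χ ↦ S_λ(1 - |χ|)` (the pole solution on `χ ≥ 0`, its reflection on `χ ≤ 0`). For
`S_λ'(1) = 0` it is smooth on `(-31/11, 31/11)` and solves the spheroidal equation there
(`exists_spheroidalEigenfunction`). DLMF §30.2–30.3. [folklore] -/
def spheroidalEigenfunction (lam c : ℝ) (χ : ℝ) : ℝ := sphFun lam c (1 - |χ|)

/-- The eigenfunction is even. [folklore] -/
theorem spheroidalEigenfunction_neg (lam c χ : ℝ) :
    spheroidalEigenfunction lam c (-χ) = spheroidalEigenfunction lam c χ := by
  simp [spheroidalEigenfunction]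

/-- `S(1) = S_λ(0) = 1`. [folklore] -/
theorem spheroidalEigenfunction_one (lam c : ℝ) : spheroidalEigenfunction lam c 1 = 1 := by
  simp [spheroidalEigenfunction, sphFun_zero]

section Glue

variable {lam c : ℝ} (hlam : |lam| ≤ 1 / 2) (hc0 : 0 ≤ c) (hc1 : c ≤ 1 / 100)
  (hg : sphDer lam c 1 = 0)
include hlam hc0 hc1 hg

/-- Near every `χ > -9/11` the eigenfunction is the pole solution `S_λ(1 - χ)`. [folklore] -/
theorem spheroidalEigenfunction_eventuallyEq_sub {χ : ℝ} (hχ : -9 / 11 < χ) :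
    spheroidalEigenfunction lam c =ᶠ[𝓝 χ] fun x ↦ sphFun lam c (1 - x) := by
  rcases lt_or_ge χ (9 / 11) with h | h
  · filter_upwards [Ioo_mem_nhds hχ h] with x hx
    unfold spheroidalEigenfunction
    rcases le_or_gt 0 x with hx0 | hx0
    · rw [abs_of_nonneg hx0]
    · rw [abs_of_neg hx0, sub_neg_eq_add]
      exact sphFun_reflect hlam hc0 hc1 hg hx
  · filter_upwards [Ioi_mem_nhds (show (0 : ℝ) < χ by linarith)] with x hx
    unfold spheroidalEigenfunction
    rw [abs_of_pos hx]

/-- Near every `χ < 9/11` the eigenfunction is the reflected pole solution `S_λ(1 + χ)`.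
[folklore] -/
theorem spheroidalEigenfunction_eventuallyEq_add {χ : ℝ} (hχ : χ < 9 / 11) :
    spheroidalEigenfunction lam c =ᶠ[𝓝 χ] fun x ↦ sphFun lam c (1 + x) := by
  rcases lt_or_ge (-9 / 11) χ with h | h
  · filter_upwards [Ioo_mem_nhds h hχ] with x hx
    unfold spheroidalEigenfunction
    rcases le_or_gt 0 x with hx0 | hx0
    · rw [abs_of_nonneg hx0]
      exact (sphFun_reflect hlam hc0 hc1 hg hx).symm
    · rw [abs_of_neg hx0, sub_neg_eq_add]
  · filter_upwards [Iio_mem_nhds (show χ < 0 by linarith)] with x hx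
    unfold spheroidalEigenfunction
    rw [abs_of_neg hx, sub_neg_eq_add]

/-- **Smoothness across both poles**: the eigenfunction is `Cⁿ` (every `n ≤ ω`) at every
`χ ∈ (-31/11, 31/11)`. [folklore] -/
theorem contDiffAt_spheroidalEigenfunction {χ : ℝ} (hχ : χ ∈ Ioo (-31 / 11 : ℝ) (31 / 11))
    {n : WithTop ℕ∞} : ContDiffAt ℝ n (spheroidalEigenfunction lam c) χ := by
  rcases lt_or_ge χ (9 / 11) with h | h
  · have hs : |1 + χ| < 20 / 11 := by
      rw [abs_lt]; constructor <;> linarith [hχ.1, hχ.2]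
    have hsm : ContDiffAt ℝ n (fun x ↦ sphFun lam c (1 + x)) χ :=
      (contDiffAt_sphFun hlam hc0 hc1 hs).comp χ (contDiffAt_const.add contDiffAt_id)
    exact hsm.congr_of_eventuallyEq (spheroidalEigenfunction_eventuallyEq_add hlam hc0 hc1 hg h)
  · have hs : |1 - χ| < 20 / 11 := by
      rw [abs_lt]; constructor <;> linarith [hχ.1, hχ.2]
    have hsm : ContDiffAt ℝ n (fun x ↦ sphFun lam c (1 - x)) χ :=
      (contDiffAt_sphFun hlam hc0 hc1 hs).comp χ (contDiffAt_const.sub contDiffAt_id)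
    exact hsm.congr_of_eventuallyEq
      (spheroidalEigenfunction_eventuallyEq_sub hlam hc0 hc1 hg (by linarith))

/-- **The spheroidal equation for the glued eigenfunction** on `(-31/11, 31/11)`:
`(1 - χ²) S'' - 2χ S' + (λ - cχ²) S = 0` with genuine derivatives `deriv S`, `deriv (deriv S)`.
[folklore] -/
theorem spheroidalEigenfunction_ode {χ : ℝ} (hχ : χ ∈ Ioo (-31 / 11 : ℝ) (31 / 11)) :
    (1 - χ ^ 2) * deriv (deriv (spheroidalEigenfunction lam c)) χ -
      2 * χ * deriv (spheroidalEigenfunction lam c) χ +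
      (lam - c * χ ^ 2) * spheroidalEigenfunction lam c χ = 0 := by
  rcases lt_or_ge χ (9 / 11) with h | h
  · -- use the reflected pole solution `x ↦ S_λ(1 + x)`
    have hs : |1 + χ| < 20 / 11 := by
      rw [abs_lt]; constructor <;> linarith [hχ.1, hχ.2]
    have hloc := spheroidalEigenfunction_eventuallyEq_add hlam hc0 hc1 hg h
    have hadd : ∀ x : ℝ, HasDerivAt (fun y : ℝ ↦ 1 + y) 1 x := fun x ↦ by
      simpa using (hasDerivAt_id x).const_add 1
    -- first derivatives near `χ`
    have hD1 : ∀ x : ℝ, |1 + x| < 20 / 11 →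
        HasDerivAt (fun y ↦ sphFun lam c (1 + y)) (sphDer lam c (1 + x)) x := fun x hx ↦ by
      simpa [Function.comp_def] using (hasDerivAt_sphFun hlam hc0 hc1 hx).comp x (hadd x)
    have hderiv_loc : deriv (spheroidalEigenfunction lam c) =ᶠ[𝓝 χ]
        fun x ↦ sphDer lam c (1 + x) := by
      have hopen : ∀ᶠ x in 𝓝 χ, |1 + x| < 20 / 11 := by
        have : Ioo (-31 / 11 : ℝ) (9 / 11) ∈ 𝓝 χ := Ioo_mem_nhds hχ.1 h
        filter_upwards [this] with x hx
        rw [abs_lt]; constructor <;> linarith [hx.1, hx.2]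
      filter_upwards [hloc.eventually_nhds, hopen] with x hx hx'
      rw [Filter.EventuallyEq.deriv_eq hx]
      exact (hD1 x hx').deriv
    have e0 : spheroidalEigenfunction lam c χ = sphFun lam c (1 + χ) := hloc.eq_of_nhds
    have e1 : deriv (spheroidalEigenfunction lam c) χ = sphDer lam c (1 + χ) :=
      hderiv_loc.eq_of_nhds
    have e2 : deriv (deriv (spheroidalEigenfunction lam c)) χ = sphDer₂ lam c (1 + χ) := by
      rw [hderiv_loc.deriv_eq]
      have := (hasDerivAt_sphDer hlam hc0 hc1 hs).comp χ (hadd χ)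
      simpa [Function.comp_def] using this.deriv
    rw [e0, e1, e2]
    have hode := sphFun_ode hlam hc0 hc1 hs
    linear_combination hode
  · -- use the pole solution `x ↦ S_λ(1 - x)`
    have hs : |1 - χ| < 20 / 11 := by
      rw [abs_lt]; constructor <;> linarith [hχ.1, hχ.2]
    have hloc := spheroidalEigenfunction_eventuallyEq_sub hlam hc0 hc1 hg
      (show (-9 / 11 : ℝ) < χ by linarith)
    have hsub : ∀ x : ℝ, HasDerivAt (fun y : ℝ ↦ 1 - y) (-1) x := fun x ↦ by
      simpa using (hasDerivAt_id x).const_sub 1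
    have hD1 : ∀ x : ℝ, |1 - x| < 20 / 11 →
        HasDerivAt (fun y ↦ sphFun lam c (1 - y)) (-sphDer lam c (1 - x)) x := fun x hx ↦ by
      simpa [Function.comp_def] using (hasDerivAt_sphFun hlam hc0 hc1 hx).comp x (hsub x)
    have hderiv_loc : deriv (spheroidalEigenfunction lam c) =ᶠ[𝓝 χ]
        fun x ↦ -sphDer lam c (1 - x) := by
      have hopen : ∀ᶠ x in 𝓝 χ, |1 - x| < 20 / 11 := by
        have : Ioo (-9 / 11 : ℝ) (31 / 11) ∈ 𝓝 χ := Ioo_mem_nhds (by linarith) hχ.2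
        filter_upwards [this] with x hx
        rw [abs_lt]; constructor <;> linarith [hx.1, hx.2]
      filter_upwards [hloc.eventually_nhds, hopen] with x hx hx'
      rw [Filter.EventuallyEq.deriv_eq hx]
      exact (hD1 x hx').deriv
    have e0 : spheroidalEigenfunction lam c χ = sphFun lam c (1 - χ) := hloc.eq_of_nhds
    have e1 : deriv (spheroidalEigenfunction lam c) χ = -sphDer lam c (1 - χ) :=
      hderiv_loc.eq_of_nhds
    have e2 : deriv (deriv (spheroidalEigenfunction lam c)) χ = sphDer₂ lam c (1 - χ) := by
      rw [hderiv_loc.deriv_eq]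
      have := ((hasDerivAt_sphDer hlam hc0 hc1 hs).comp χ (hsub χ)).neg
      simpa [Function.comp_def] using this.deriv
    rw [e0, e1, e2]
    have hode := sphFun_ode hlam hc0 hc1 hs
    linear_combination hode

end Glue

/-- **A smooth even spheroidal eigenfunction (`c = 1/100`).** There are `λ ∈ [-1/2, 1/2]` and
`S : ℝ → ℝ`, `C^∞` on the open interval `(-31/11, 31/11) ⊃ [-1, 1]`, even, with `S(1) = 1`, such
that `(1 - χ²) S''(χ) - 2χ S'(χ) + (λ - χ²/100) S(χ) = 0` for all `χ ∈ (-31/11, 31/11)` — a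
solution of the axisymmetric prolate spheroidal equation regular at both poles `χ = ±1`
(DLMF §30.2–30.3; Flammer 1957, Ch. 2; the angular ODE of SR, CMP 329 (2014), §2 with `m = 0`,
`a²(μ² - ω²) = 1/100`). [cite: ShlapentokhRothman2014KleinGordon, §2] -/
theorem exists_spheroidalEigenfunction :
    ∃ lam : ℝ, |lam| ≤ 1 / 2 ∧ ∃ S : ℝ → ℝ,
      ContDiffOn ℝ ⊤ S (Ioo (-31 / 11 : ℝ) (31 / 11)) ∧ S 1 = 1 ∧ (∀ χ, S (-χ) = S χ) ∧
      ∀ χ ∈ Ioo (-31 / 11 : ℝ) (31 / 11),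
        (1 - χ ^ 2) * deriv (deriv S) χ - 2 * χ * deriv S χ +
          (lam - 1 / 100 * χ ^ 2) * S χ = 0 := by
  obtain ⟨lam, hlam, hg⟩ := exists_sphDer_one_eq_zero
  have hlam' : |lam| ≤ 1 / 2 := by
    rw [abs_le]; constructor <;> linarith [hlam.1, hlam.2]
  refine ⟨lam, hlam', spheroidalEigenfunction lam (1 / 100), fun χ hχ ↦ ?_,
    spheroidalEigenfunction_one _ _, spheroidalEigenfunction_neg _ _, fun χ hχ ↦ ?_⟩
  · exact (contDiffAt_spheroidalEigenfunction hlam' (by norm_num) (by norm_num) hg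
      hχ).contDiffWithinAt
  · exact spheroidalEigenfunction_ode hlam' (by norm_num) (by norm_num) hg hχ

end Literature.Analysis.SpecialFunctions
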